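import Mathlib
import HarnessLib
import Literature.Analysis.FunctionSpaces.SmoothParametricIntegral
import Summits.Ventures.LatticeQCDFlow.Exactness.SphereFlowTransport
import Summits.Ventures.LatticeQCDFlow.Exactness.SphereTimeDependentFlow

/-!
# The transport identity with a source term, `(d/ds)∫K_s dπ̄ = ∫K_s(−Σ∂̃²G_s + q_s)dπ̄` whenever `∂_sK_s = DK_s·∂̃G_s + q_sK_s` on `Ω`, and the two regularity facts the Jacobian leg needs: joint `C¹` smoothness of `(u, x) ↦ ∂̃_n·∂̃_nG_u(x)` for a jointly `C³` generator, and `C¹` parametric primitives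

HONEST FRAMING: exact (Metropolis-corrected) sampling algorithms for lattice gauge theory;
figures of merit are autocorrelation/cost numbers at stated couplings and volumes; no
continuum-physics claim.

Venture `LatticeQCDFlow` (cell pub-lqcd), topic `Exactness`; FANOUT row 7 (`s0-cpn-null`: the
S0-D1 rung — 2D CP⁹, Lüscher's LO trivializing map inside HMC, Engel–Schaefer 2011).  NEW WORK of
the cell over the tree's `Exactness/SphereFlowTransport.lean` (GEN-14: the transport identity
`(d/ds)∫e^{−sS}(H∘Ψ_s)dπ̄ = ∫e^{−sS}(H∘Ψ_s)(𝓛_sG_s − S)dπ̄` for a pull-back family `Ψ_s`, and the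
Green identity read from the right `∫e^{−tS}DK·∂̃G dπ̄ = ∫e^{−tS}K·𝓛_tG dπ̄`),
`Exactness/SphereTimeDependentFlow.lean` (GEN-14: parametric smoothness of `∂̃`, the cut-off
pattern "off the poles a product of smooth maps, near a pole identically zero"),
`Exactness/SphereLatticeGreen.lean` (GEN-8: `contDiffAt_comp_update_normalize`, the site Laplacian
as a trace over an orthonormal basis) and the tree's PROVED
`Literature/Analysis/FunctionSpaces/SmoothParametricIntegral.lean` (one derivative under the
integral sign over a compact interval) and `Literature/Analysis/PDE/RellichSphericalMoments.lean`
(differentiation under `∫dν` over a compact space); nothing is cited as a fact.  Printed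
counterpart, NAMED ONLY: M. Lüscher, "Trivializing maps, the Wilson flow and the HMC algorithm",
Commun. Math. Phys. 293 (2010) 899, §3.2 eqs. (3.6)–(3.9): the Jacobian of the flow map through
`(d/dt) ln det Φ_t^* = −(∂∂S̃_t)∘Φ_t` (Liouville's formula); L. C. Evans, PDE, App. C (calculus
facts).

GEN-14 transported a FIXED observable `H` along the flow against the FIXED tilt `e^{−sS}`; the
Jacobian / Liouville leg (sequel `Exactness/SphereFlowLiouville.lean`) needs an `s`-DEPENDENT
weight `e^{B_s}` solving a transport equation along the characteristics.  THIS FILE supplies the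
three ingredients:

* §1 **PARAMETRIC SMOOTHNESS OF THE SITE LAPLACIAN**: for a generator family `G_u(x)` jointly
  `C³` in `(u, x)`, `(u, x) ↦ ∂̃_n·∂̃_nG_u(x)` is jointly `C¹` at every `(u, x)` with `x_n ≠ 0`
  (**`contDiffAt_siteLaplacian_param`**), and the cut-off Laplacian
  `(u, x) ↦ χ(x)·Σ_n∂̃_n·∂̃_nG_u(x)` is `C¹` on all of `ℝ × (Λ → E)`
  (**`contDiff_sphereCutoff_mul_sum_siteLaplacian`**; `χ = 1` on `Ω̃`).
* §2 **`C¹` PARAMETRIC INTEGRALS AND PRIMITIVES** (folklore calculus, proved here from the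
  Literature lemma): for `F : ℝ × Q → ℝ` of class `C¹` (`Q` finite-dimensional),
  `p ↦ ∫ σ in a..b, F(σ, p)` is `C¹` (**`contDiff_one_parametric_intervalIntegral`**) and so is the
  primitive with variable upper limit `(τ, q) ↦ ∫ s in 0..τ, F(s, q)`
  (**`contDiff_one_parametric_primitive`**).
* §3 **THE TRANSPORT IDENTITY WITH A SOURCE TERM** (**`hasDerivAt_integral_family_source`**):
  for a jointly `C¹` family `K_s(x)`, generators `G_s ∈ C²` with jointly continuous natural
  gradients on `ℝ × Ω`, and a source `q_s(ω)` jointly continuous on `ℝ × Ω`, IF on `Ω`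
  `(d/ds)K_s(ω) = DK_s(ω)·∂̃G_s(ω) + q_s(ω)K_s(ω)` THEN
  `(d/ds)∫K_s dπ̄ = ∫K_s·(−Σ_n∂̃_n·∂̃_nG_s + q_s)dπ̄`
  (differentiate under `∫dπ̄`, integrate `DK_s·∂̃G_s` by parts with the untilted Green identity
  `∫DK·∂̃G dπ̄ = ∫K·(−Σ∂̃²G)dπ̄`).  GEN-14's identity is the instance `K_s = e^{−sS}(H∘Ψ_s)`,
  `q_s = sΣ⟨∂̃S, ∂̃G_s⟩ − S`; the sequel's is `K_s = e^{B_s}(H∘Φ_{s→c})`, `q_s = Σ∂̃²G_s`, for which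
  the right-hand side VANISHES: the integral is conserved and `e^{B_0}` is the Jacobian of `Φ_{0→c}`.

NOT CLAIMED: anything about the flow itself (sequel); higher (`C^n`, `n ≥ 2`) parametric
regularity; anything quantitative, about autocorrelations or the rung's numbers.
-/

noncomputable section

namespace Summit.Ventures.LatticeQCDFlow.Exactness

open Function Set Metric MeasureTheory NormedSpace InnerProductSpace Laplacian
open scoped RealInnerProductSpace Topology

variable {Λ : Type*} {E : Type*} [NormedAddCommGroup E] [InnerProductSpace ℝ E] [Fintype Λ]
  [DecidableEq Λ]

/-! ## §1 Parametric smoothness of the site Laplacian -/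

section Laplacian

variable {G : ℝ → (Λ → E) → ℝ}

/-- **Parametric smoothness of E–S's site Laplacian**: for a family `G_u(x)` jointly `C³` in
`(u, x)`, `(u, x) ↦ ∂̃_n·∂̃_nG_u(x)` is jointly `C¹` at every `(u, x)` with `x_n ≠ 0` (the second
`y`-derivative of the doubly parametrised section `((u, x), y) ↦ G_u(x[n ← y/‖y‖])`, traced over an
orthonormal basis). -/
theorem contDiffAt_siteLaplacian_param [FiniteDimensional ℝ E]
    (hG : ContDiff ℝ 3 fun q : ℝ × (Λ → E) => G q.1 q.2) (n : Λ) {q : ℝ × (Λ → E)}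
    (hq : q.2 n ≠ 0) :
    ContDiffAt ℝ 1 (fun q' : ℝ × (Λ → E) => siteLaplacian n (G q'.1) q'.2) q := by
  set b := stdOrthonormalBasis ℝ E
  -- the doubly parametrised section is `C³` at `((q, q_n), q_n)`
  have h3 : ContDiffAt ℝ 3 (uncurry fun (p : (ℝ × (Λ → E)) × E) (y' : E) =>
      G p.1.1 (update p.1.2 n (normalize y'))) ((q, q.2 n), q.2 n) := by
    have hA : ContDiffAt ℝ 3 (fun r : ((ℝ × (Λ → E)) × E) × E => normalize r.2)
        ((q, q.2 n), q.2 n) :=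
      ContDiffAt.comp ((q, q.2 n), q.2 n) (contDiffAt_normalize hq) contDiffAt_snd
    have hB : ContDiffAt ℝ 3 (fun r : ((ℝ × (Λ → E)) × E) × E => (r.1.1.2, normalize r.2))
        ((q, q.2 n), q.2 n) :=
      (ContDiffAt.comp ((q, q.2 n), q.2 n) contDiffAt_snd
        (contDiffAt_fst.comp _ contDiffAt_fst)).prodMk hA
    have hC : ContDiffAt ℝ 3 (fun r : ((ℝ × (Λ → E)) × E) × E => update r.1.1.2 n (normalize r.2))
        ((q, q.2 n), q.2 n) :=
      ContDiffAt.comp ((q, q.2 n), q.2 n) (contDiff_update_prod n).contDiffAt hB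
    have hD : ContDiffAt ℝ 3 (fun r : ((ℝ × (Λ → E)) × E) × E =>
        ((r.1.1.1, update r.1.1.2 n (normalize r.2)) : ℝ × (Λ → E))) ((q, q.2 n), q.2 n) :=
      (ContDiffAt.comp ((q, q.2 n), q.2 n) contDiffAt_fst
        (contDiffAt_fst.comp _ contDiffAt_fst)).prodMk hC
    exact ContDiffAt.comp ((q, q.2 n), q.2 n) hG.contDiffAt hD
  -- its first `y`-derivative, as a function of ((u, x), y), is `C²` at `(q, q_n)`
  have h2 : ContDiffAt ℝ 2 (uncurry fun (p : ℝ × (Λ → E)) (y : E) =>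
      fderiv ℝ (fun y' : E => G p.1 (update p.2 n (normalize y'))) y) (q, q.2 n) :=
    h3.fderiv contDiffAt_snd (by norm_num)
  -- the second `y`-derivative at `y = x_n` is jointly `C¹` at `q`
  have h1 : ContDiffAt ℝ 1 (fun q' : ℝ × (Λ → E) =>
      fderiv ℝ (fderiv ℝ (fun y : E => G q'.1 (update q'.2 n (normalize y)))) (q'.2 n)) q :=
    h2.fderiv (((contDiff_apply ℝ E n).comp contDiff_snd).contDiffAt) (by norm_num)
  have hfun : (fun q' : ℝ × (Λ → E) => siteLaplacian n (G q'.1) q'.2) = fun q' => ∑ i,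
      fderiv ℝ (fderiv ℝ (fun y : E => G q'.1 (update q'.2 n (normalize y)))) (q'.2 n)
        (b i) (b i) := by
    funext q'
    rw [siteLaplacian, laplacian_eq_iteratedFDeriv_orthonormalBasis _ b]
    simp only [iteratedFDeriv_two_apply, Matrix.cons_val_zero, Matrix.cons_val_one]
  rw [hfun]
  exact ContDiffAt.sum fun i _ => (h1.clm_apply contDiffAt_const).clm_apply contDiffAt_const

/-- `(u, ω) ↦ ∂̃_n·∂̃_nG_u(ω)` is jointly continuous on `ℝ × Ω` (jointly `C³` family). -/
theorem continuous_siteLaplacian_param_sphereConfig [FiniteDimensional ℝ E]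
    (hG : ContDiff ℝ 3 fun q : ℝ × (Λ → E) => G q.1 q.2) (n : Λ) :
    Continuous fun p : ℝ × (Λ → sphere (0 : E) 1) =>
      siteLaplacian n (G p.1) (fun m => (p.2 m : E)) := by
  refine continuous_iff_continuousAt.2 fun p => ?_
  have h := (contDiffAt_siteLaplacian_param hG n (q := (p.1, fun m => (p.2 m : E)))
    (sphereConfig_ne_zero p.2 n)).continuousAt
  have h2 : ContinuousAt ((fun q' : ℝ × (Λ → E) => siteLaplacian n (G q'.1) q'.2) ∘
      fun p' : ℝ × (Λ → sphere (0 : E) 1) => ((p'.1, fun m => (p'.2 m : E)) : ℝ × (Λ → E))) p :=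
    ContinuousAt.comp_of_eq h
      (continuous_fst.prodMk (continuous_sphereConfig.comp continuous_snd)).continuousAt rfl
  exact h2

/-- **The cut-off Laplacian `(u, x) ↦ χ(x)·Σ_n∂̃_n·∂̃_nG_u(x)` is `C¹` on `ℝ × (Λ → E)`** for a
jointly `C³` family: off the poles a product of `C¹` maps, near a pole identically zero
(`χ = 0` as soon as one site variable is short).  On `Ω̃` the cut-off is `1`. -/
theorem contDiff_sphereCutoff_mul_sum_siteLaplacian [FiniteDimensional ℝ E]
    (hG : ContDiff ℝ 3 fun q : ℝ × (Λ → E) => G q.1 q.2) :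
    ContDiff ℝ 1 fun q : ℝ × (Λ → E) =>
      sphereCutoff q.2 * ∑ n, siteLaplacian n (G q.1) q.2 := by
  refine contDiff_iff_contDiffAt.2 fun q₀ => ?_
  by_cases h : ∀ m, q₀.2 m ≠ 0
  · exact ((contDiff_sphereCutoff 1).comp contDiff_snd).contDiffAt.mul
      (ContDiffAt.sum fun n _ => contDiffAt_siteLaplacian_param hG n (h n))
  · simp only [ne_eq, not_forall, not_not] at h
    obtain ⟨m, hm⟩ := h
    have hm' : ‖q₀.2 m‖ ^ 2 < 1 / 4 := by rw [hm, norm_zero]; norm_num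
    have hopen : IsOpen {q : ℝ × (Λ → E) | ‖q.2 m‖ ^ 2 < 1 / 4} :=
      isOpen_lt (((continuous_apply m).comp continuous_snd).norm.pow 2) continuous_const
    have hev : (fun q : ℝ × (Λ → E) => sphereCutoff q.2 * ∑ n, siteLaplacian n (G q.1) q.2)
        =ᶠ[𝓝 q₀] fun _ => 0 := by
      filter_upwards [hopen.mem_nhds hm'] with q hq
      simp only [sphereCutoff_eq_zero_of_le (le_of_lt hq), zero_mul]
    exact (contDiffAt_const (c := (0 : ℝ))).congr_of_eventuallyEq hev

end Laplacian

/-! ## §2 `C¹` parametric integrals and primitives -/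

section Parametric

variable {Q : Type*} [NormedAddCommGroup Q] [NormedSpace ℝ Q] [FiniteDimensional ℝ Q]

/-- **`C¹` dependence on parameters of an integral over a compact interval**: for
`F : ℝ × Q → ℝ` of class `C¹` (`Q` finite-dimensional), `p ↦ ∫ σ in a..b, F(σ, p)` is `C¹`
(one derivative under the integral sign, `Literature…hasFDerivAt_parametric_intervalIntegral`, and
continuity of the parametric integral of the continuous partial derivative).  Folklore
(Evans, PDE, App. C). -/
theorem contDiff_one_parametric_intervalIntegral {F : ℝ × Q → ℝ} (hF : ContDiff ℝ 1 F) (a b : ℝ) :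
    ContDiff ℝ 1 fun p : Q => ∫ σ in a..b, F (σ, p) := by
  have hD : ∀ p, HasFDerivAt (fun p : Q => ∫ σ in a..b, F (σ, p))
      (∫ σ in a..b, (fderiv ℝ F (σ, p)).comp (ContinuousLinearMap.inr ℝ ℝ Q)) p := fun p =>
    Literature.Analysis.FunctionSpaces.hasFDerivAt_parametric_intervalIntegral hF one_ne_zero a b p
  rw [contDiff_one_iff_fderiv]
  refine ⟨fun p => (hD p).differentiableAt, ?_⟩
  have heq : (fderiv ℝ fun p : Q => ∫ σ in a..b, F (σ, p)) =
      fun p => ∫ σ in a..b, (fderiv ℝ F (σ, p)).comp (ContinuousLinearMap.inr ℝ ℝ Q) :=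
    funext fun p => (hD p).fderiv
  rw [heq]
  have hc : Continuous fun z : ℝ × Q => (fderiv ℝ F z).comp (ContinuousLinearMap.inr ℝ ℝ Q) :=
    ((ContinuousLinearMap.compL ℝ Q (ℝ × Q) ℝ).flip
      (ContinuousLinearMap.inr ℝ ℝ Q)).continuous.comp (hF.continuous_fderiv one_ne_zero)
  exact intervalIntegral.continuous_parametric_intervalIntegral_of_continuous'
    (f := fun p σ => (fderiv ℝ F (σ, p)).comp (ContinuousLinearMap.inr ℝ ℝ Q))
    (hc.comp (continuous_snd.prodMk continuous_fst)) a b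

/-- **`C¹` parametric primitive**: for `F : ℝ × Q → ℝ` of class `C¹`, the primitive with variable
upper limit `(τ, q) ↦ ∫ s in 0..τ, F(s, q)` is `C¹` on `ℝ × Q` (the substitution `s = τθ` turns it
into the fixed-limits integral `∫ θ in 0..1, τ·F(τθ, q)` of a `C¹` integrand).  Folklore. -/
theorem contDiff_one_parametric_primitive {F : ℝ × Q → ℝ} (hF : ContDiff ℝ 1 F) :
    ContDiff ℝ 1 fun z : ℝ × Q => ∫ s in (0 : ℝ)..z.1, F (s, z.2) := by
  have heq : (fun z : ℝ × Q => ∫ s in (0 : ℝ)..z.1, F (s, z.2))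
      = fun z : ℝ × Q => ∫ θ in (0 : ℝ)..1, z.1 * F (z.1 * θ, z.2) := by
    funext z
    have h1 := intervalIntegral.smul_integral_comp_mul_left (f := fun s => F (s, z.2)) (a := (0 : ℝ))
      (b := 1) z.1
    simp only [mul_zero, mul_one, smul_eq_mul] at h1
    rw [intervalIntegral.integral_const_mul, h1]
  rw [heq]
  refine contDiff_one_parametric_intervalIntegral
    (F := fun r : ℝ × (ℝ × Q) => r.2.1 * F (r.2.1 * r.1, r.2.2)) ?_ 0 1
  have h1 : ContDiff ℝ 1 fun r : ℝ × (ℝ × Q) => (r.2.1 * r.1, r.2.2) := by fun_prop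
  exact (contDiff_fst.comp contDiff_snd).mul (hF.comp h1)

end Parametric

/-! ## §3 The transport identity with a source term -/

section Transport

variable [FiniteDimensional ℝ E] [MeasurableSpace E] [BorelSpace E] [Nontrivial E]

/-- **The untilted Green identity read from the right**: for `K ∈ C¹`, `G ∈ C²`,
`∫ DK·∂̃G dπ̄ = ∫ K·(−Σ_n∂̃_n·∂̃_nG) dπ̄` (GEN-14's tilted form at `t = 0`). -/
theorem integral_fderiv_apply_siteGrad_eq_neg_sum_siteLaplacian {K G : (Λ → E) → ℝ}
    (hK : ContDiff ℝ 1 K) (hG : ContDiff ℝ 2 G) :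
    ∫ ω, fderiv ℝ K (fun m => ((ω : Λ → sphere (0 : E) 1) m : E))
        (fun n => siteGrad n G (fun m => (ω m : E)))
          ∂Measure.pi (fun _ : Λ => uniformSphere (volume : Measure E)) =
      ∫ ω, K (fun m => ((ω : Λ → sphere (0 : E) 1) m : E)) *
        -∑ n, siteLaplacian n G (fun m => (ω m : E))
          ∂Measure.pi (fun _ : Λ => uniformSphere (volume : Measure E)) := by
  have h := integral_exp_mul_fderiv_apply_siteGrad (Λ := Λ) (E := E) (S := fun _ => (0 : ℝ))
    contDiff_const hK hG 0
  simp only [zero_mul, neg_zero, Real.exp_zero, one_mul, sphereLuscherL_zero] at h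
  exact h

/-- **THE TRANSPORT IDENTITY WITH A SOURCE TERM.**  Let `K : ℝ → (Λ → E) → ℝ` be jointly `C¹`,
`G_s ∈ C²` a family of generators whose natural gradients are jointly continuous on `ℝ × Ω`, and
`q_s` a source jointly continuous on `ℝ × Ω`, with ON `Ω`
`(d/ds) K_s(ω) = DK_s(ω)·∂̃G_s(ω) + q_s(ω)·K_s(ω)` (the family is transported by the flow
`ẋ = −∂̃G_s(x)` up to the multiplicative source `q_s`).  Then for every real `s₀`
`(d/ds)|_{s₀} ∫ K_s dπ̄ = ∫ K_{s₀}·(−Σ_n∂̃_n·∂̃_nG_{s₀} + q_{s₀}) dπ̄`. -/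
theorem hasDerivAt_integral_family_source {K q Gs : ℝ → (Λ → E) → ℝ}
    (hK : ContDiff ℝ 1 fun p : ℝ × (Λ → E) => K p.1 p.2) (hGs : ∀ s, ContDiff ℝ 2 (Gs s))
    (hV : ∀ n, Continuous fun p : ℝ × (Λ → sphere (0 : E) 1) =>
      siteGrad n (Gs p.1) (fun m => (p.2 m : E)))
    (hq : Continuous fun p : ℝ × (Λ → sphere (0 : E) 1) => q p.1 (fun m => (p.2 m : E)))
    (hderiv : ∀ (s : ℝ) (ω : Λ → sphere (0 : E) 1),
      HasDerivAt (fun s' => K s' (fun m => (ω m : E)))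
        (fderiv ℝ (K s) (fun m => (ω m : E)) (fun n => siteGrad n (Gs s) (fun m => (ω m : E))) +
          q s (fun m => (ω m : E)) * K s (fun m => (ω m : E))) s)
    (s₀ : ℝ) :
    HasDerivAt (fun s => ∫ ω, K s (fun m => ((ω : Λ → sphere (0 : E) 1) m : E))
        ∂Measure.pi (fun _ : Λ => uniformSphere (volume : Measure E)))
      (∫ ω, K s₀ (fun m => ((ω : Λ → sphere (0 : E) 1) m : E)) *
          (-(∑ n, siteLaplacian n (Gs s₀) (fun m => (ω m : E))) + q s₀ (fun m => (ω m : E)))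
        ∂Measure.pi (fun _ : Λ => uniformSphere (volume : Measure E))) s₀ := by
  have hKs : ∀ s, ContDiff ℝ 1 (K s) := fun s => hK.comp (contDiff_const.prodMk contDiff_id)
  -- joint continuity of the integrand and of its `s`-derivative on `ℝ × Ω`
  have hcoe : Continuous fun p : ℝ × (Λ → sphere (0 : E) 1) =>
      ((p.1, fun m => (p.2 m : E)) : ℝ × (Λ → E)) :=
    continuous_fst.prodMk (continuous_sphereConfig.comp continuous_snd)
  have hKc : Continuous fun p : ℝ × (Λ → sphere (0 : E) 1) => K p.1 (fun m => (p.2 m : E)) :=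
    hK.continuous.comp hcoe
  have hD : Continuous fun p : ℝ × (Λ → sphere (0 : E) 1) =>
      fderiv ℝ (K p.1) (fun m => (p.2 m : E)) (fun n => siteGrad n (Gs p.1) (fun m => (p.2 m : E))) := by
    have h1 : ContDiff ℝ 1 (uncurry fun (r : ℝ × (Λ → E)) (z : Λ → E) => K r.1 z) :=
      hK.comp ((contDiff_fst.comp contDiff_fst).prodMk contDiff_snd)
    have h2 := (Continuous.fderiv_one h1 continuous_snd).comp hcoe
    have h3 : Continuous fun p : ℝ × (Λ → sphere (0 : E) 1) =>
        fun n => siteGrad n (Gs p.1) (fun m => (p.2 m : E)) :=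
      continuous_pi fun n => hV n
    exact h2.clm_apply h3
  have hF : Continuous (uncurry fun (s : ℝ) (ω : Λ → sphere (0 : E) 1) =>
      K s (fun m => (ω m : E))) := hKc
  have hF' : Continuous (uncurry fun (s : ℝ) (ω : Λ → sphere (0 : E) 1) =>
      fderiv ℝ (K s) (fun m => (ω m : E)) (fun n => siteGrad n (Gs s) (fun m => (ω m : E))) +
        q s (fun m => (ω m : E)) * K s (fun m => (ω m : E))) :=
    hD.add (hq.mul hKc)
  have hmain := Literature.Analysis.PDE.Rellich.hasDerivAt_integral_of_continuous
    (ν := Measure.pi (fun _ : Λ => uniformSphere (volume : Measure E))) hF hF' hderiv s₀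
  refine hmain.congr_deriv ?_
  -- evaluate `∫ F'(s₀, ·) dπ̄` by the untilted Green identity
  have hcK : Continuous fun ω : Λ → sphere (0 : E) 1 => K s₀ (fun m => (ω m : E)) :=
    hKc.comp (Continuous.prodMk_right s₀)
  have hcD : Continuous fun ω : Λ → sphere (0 : E) 1 =>
      fderiv ℝ (K s₀) (fun m => (ω m : E)) (fun n => siteGrad n (Gs s₀) (fun m => (ω m : E))) :=
    hD.comp (Continuous.prodMk_right s₀)
  have hcq : Continuous fun ω : Λ → sphere (0 : E) 1 => q s₀ (fun m => (ω m : E)) :=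
    hq.comp (Continuous.prodMk_right s₀)
  have hcL : Continuous fun ω : Λ → sphere (0 : E) 1 =>
      ∑ n, siteLaplacian n (Gs s₀) (fun m => (ω m : E)) :=
    continuous_finsetSum _ fun n _ => continuous_siteLaplacian_sphereConfig (hGs s₀) n
  have hiA : Integrable (fun ω : Λ → sphere (0 : E) 1 =>
      fderiv ℝ (K s₀) (fun m => (ω m : E)) (fun n => siteGrad n (Gs s₀) (fun m => (ω m : E))))
        (Measure.pi fun _ : Λ => uniformSphere (volume : Measure E)) :=
    integrable_pi_of_continuous _ hcD
  have hiB : Integrable (fun ω : Λ → sphere (0 : E) 1 =>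
      q s₀ (fun m => (ω m : E)) * K s₀ (fun m => (ω m : E)))
        (Measure.pi fun _ : Λ => uniformSphere (volume : Measure E)) :=
    integrable_pi_of_continuous _ (hcq.mul hcK)
  have hiC : Integrable (fun ω : Λ → sphere (0 : E) 1 =>
      K s₀ (fun m => (ω m : E)) * -∑ n, siteLaplacian n (Gs s₀) (fun m => (ω m : E)))
        (Measure.pi fun _ : Λ => uniformSphere (volume : Measure E)) :=
    integrable_pi_of_continuous _ (hcK.mul hcL.neg)
  have hiD : Integrable (fun ω : Λ → sphere (0 : E) 1 =>
      K s₀ (fun m => (ω m : E)) * q s₀ (fun m => (ω m : E)))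
        (Measure.pi fun _ : Λ => uniformSphere (volume : Measure E)) :=
    integrable_pi_of_continuous _ (hcK.mul hcq)
  have hsplit : (fun ω : Λ → sphere (0 : E) 1 => K s₀ (fun m => (ω m : E)) *
      (-(∑ n, siteLaplacian n (Gs s₀) (fun m => (ω m : E))) + q s₀ (fun m => (ω m : E)))) =
      fun ω => K s₀ (fun m => (ω m : E)) * -∑ n, siteLaplacian n (Gs s₀) (fun m => (ω m : E)) +
        K s₀ (fun m => (ω m : E)) * q s₀ (fun m => (ω m : E)) := by
    funext ω; ring
  rw [integral_add hiA hiB, integral_fderiv_apply_siteGrad_eq_neg_sum_siteLaplacian (hKs s₀) (hGs s₀),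
    hsplit, integral_add hiC hiD]
  congr 1
  refine integral_congr_ae (ae_of_all _ fun ω => ?_)
  ring

end Transport

end Summit.Ventures.LatticeQCDFlow.Exactness

end
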